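import Literature.AlgebraicGeometry.Motives.HodgeGroupOfOrientationCharacterModule
import Literature.AlgebraicGeometry.Motives.MumfordTateGroupOfInducedOrientation
import Literature.AlgebraicGeometry.Motives.HodgeStructureOfOrientationHalfTwist
import Literature.AlgebraicGeometry.Motives.HodgeStructureOfOrientationSerreConditionTwists
import HarnessLib

/-!
# `X^*(T_λ) ⊆ Λ` under the operations of `OIF(n)`: Galois translates `gΠ` (right translation in `Λ`), induced orientations `Π′^F`
# (the SAME submodule of `Λ`), half twists `Π{b}_Θ` (`λ ↦ λ + b·λ_Θ`), and CM types (`λ_Φ ∈ {0,1}`, Milne–Shih (1.7))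

[topic AlgebraicGeometry/Motives]

Layer `Literature/AlgebraicGeometry/Motives`, lane `lit-hodgefound` (Track 2 foundations library; seat `lit-hodgefound-p02`, gen 31, row g31-#7).
THEOREMS ONLY (no definition, no named fact; D-0026 net debt `0`).  Sequel BY NAME of g31-#1 `Motives/MumfordTateGroupOfOrientationCharacterModule`
(`mtChar = λ`, `mtCharMap = X^*(ρ_μ)`, `X^*(T_λ) = range mtCharMap`, §4 `mtChar_mem_infinityTypes_iff_deg_mem_charGroup`,
`range_mtCharMap_le_infinityTypes_iff`) and g31-#4 `Motives/HodgeGroupOfOrientationCharacterModule` (`hgChar = υ`, `hgCharMap`, `mtChar_mul_starRingAut`,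
`exists_mulEquiv_hodgeGroupBaseChange_complex_ofOrientation_characterHom`), over the tree's operations on orientations: g28-#5
`Motives/HodgeStructureOfOrientationGaloisTranslates` (the translate `gΠ` in hypothesis form `deg_{Λ′} θ = deg_Λ(g⁻¹θ)`; there: SAME Hodge tensors, SAME
groups), g22-#4 `Motives/HodgeStructureOfInducedOrientation` (`Orientation.induced k Λ′ = Π′^F`, `Orientation.restrict`, `induced_restrict`) with
g27-#2 `Motives/MumfordTateGroupOfInducedOrientation` (`nonempty_mumfordTateGroupBaseChange_complex_induced_mulEquiv`; the Hodge-group version there needs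
`F, F′` CM and `n ≠ 0`), g22-#5 `Motives/HodgeStructureOfOrientationHalfTwist` (`Orientation.twist Λ Θ b = Π{b}_Θ`), `Orientation.ofCMType` and g30-#8
`Motives/HodgeStructureOfOrientationSerreConditionTwists` (`ofCMType_deg_mem_charGroup_iff_isShimuraCMType`, `isPolarizable_ofOrientation_ofCMType_iff_isShimuraCMType`).

THE PRINTS.  J. S. Milne, K.-y. Shih [MilneShih1982Taniyama] III §1 (1.3) p. 231 («`(σλ)(ρ) = λ(σ⁻¹ρ)`», `Λ^L`), (1.6) p. 232 («`X^*(T_λ)` is the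
`Gal(ℚ̄/ℚ)`-submodule of `X^*(S)` generated by `λ` … `MT(V,h) = T_λ`»), (1.7) p. 233 («`X^*(S)` is generated by functions `λ` such that `λ(σ)` is `0` or
`1` and `λ(σ) + λ(ισ) = 1` … `(V,h)` … corresponds to an abelian variety»).  M. Green, P. Griffiths, M. Kerr [GreenGriffithsKerr2012] §V.A (V.A.1) (ii),
(iv) p. 155 (sub-OIF's, `Π̃^{p,q}` = all embeddings restricting into `Π^{p,q}`), (V.A.3)–(V.A.4) p. 156 (the Galois group acts on the partition),
(V.A.7) p. 157, §V.B p. 159–160 («`V{-b/2}^{P,Q} := V_+^{P−b,Q} ⊕ V_-^{P,Q−b}`», «keeping track of where the `K`-eigenspaces have migrated»), §V.D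
(V.D.4)–(V.D.5) p. 164, §V.F pp. 172–173 («`𝔐(F)` must also contain `{ᵗσμ(f′)}`»).  B. van Geemen [vanGeemen2001HalfTwists] §2.8 (the half twist).
G. Shimura [Shimura1998] §5.2 Thm. 1 (p. 40) ((CM1)+(CM2)).

THE MECHANISM.  All four operations act on degree functions, and `λ_θ(τ) = deg(τ⁻¹θ)` transports them into `Λ`: (§1) `deg_{gΠ} = deg_Π(g⁻¹·)` gives
`λ^{gΠ}_θ(τ) = deg_Π(g⁻¹τ⁻¹θ) = λ^Π_θ(τg)` — RIGHT translation `R_g`, an automorphism of `Λ` commuting with the left Galois action, so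
`X^*(T_{λ^{gΠ}}) = R_g X^*(T_{λ^Π}) ≅ X^*(T_{λ^Π})` as Galois modules and the kernels (characters trivial on the groups) coincide; (§2)
`deg_{Π′^F}(θ) = deg_{Π′}(θ|_{F′})` and restriction of embeddings is `Aut(ℂ)`-equivariant and onto, so `λ^{Π′^F}_θ = λ^{Π′}_{θ|F′}` and the two
character modules are the SAME submodule of `Λ` (on `X^*(Res_{F/ℚ}𝔾_m)` the map is the restriction `c ↦ (σ₀ ↦ Σ_{θ|F′=σ₀} c_θ)` to `T_{F′}`), whence
`M_φ(V^n_{(F,Π′^F)})(ℂ) ≅ Hom(X^*(M_φ), ℂ^×) ≅ M_φ(V^n_{(F′,Π′)})(ℂ)` with no CM or weight hypothesis; (§3) `deg_{Π{b}_Θ} = deg_Π + b·𝟙_Θ` gives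
`λ^{Π{b}_Θ} = λ^Π + bλ^Θ`, `υ^{Π{b}_Θ} = υ^Π + bυ^Θ`, so `X^*(T_{λ^{Π{b}_Θ}}) + X^*(T_{λ^Θ}) = X^*(T_{λ^Π}) + X^*(T_{λ^Θ})`; (§4) `deg_Φ = 𝟙_Φ` gives
`λ^Φ_θ(τ) = [τ⁻¹θ ∈ Φ] ∈ {0,1}` with `λ^Φ_θ(τ) + λ^Φ_θ(τι) = 1` — (1.7)'s generators — and `λ^Φ_θ ∈ X^*(S)` iff `Φ` is a SHIMURA CM type.

WHAT IS PROVED (`F = K : Type` a number field, `Λ : Orientation K n`; `[HodgeTensorFacts.{0,0}]` only for the group isomorphism of §2).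
* §1 (`hΛ′ : deg_{Λ′} θ = deg_Λ(g⁻¹θ)`) **`mtChar_of_deg_eq`** (`λ^{gΠ}_θ(τ) = λ^Π_θ(τg)`), `hgChar_of_deg_eq`, `mtCharMap_of_deg_eq`, `hgCharMap_of_deg_eq`,
  **`mtCharMap_eq_zero_iff_of_deg_eq`** / `hgCharMap_eq_zero_iff_of_deg_eq` (same characters trivial on `M_φ̃` / `M_φ`), **`range_mtCharMap_of_deg_eq`**
  (`X^*(T_{λ^{gΠ}}) = R_g X^*(T_{λ^Π})`), `range_hgCharMap_of_deg_eq`, **`exists_linearEquiv_range_mtCharMap_of_deg_eq`** (`R_g` is a `ℤ[Gal]`-isomorphism).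
* §2 (`k : F′ →+* F`, `Λ′ : Orientation F′ n`) **`mtChar_induced`** (`λ^{Π′^F}_θ = λ^{Π′}_{θ∘k}`), `hgChar_induced`, **`mtCharMap_induced`** (restriction of
  characters to `T_{F′}`), **`range_mtCharMap_induced`** / **`range_hgCharMap_induced`** (the SAME submodules of `Λ`), `range_mtCharMap_restrict`,
  `range_hgCharMap_restrict`, **`nonempty_hodgeGroupBaseChange_complex_induced_mulEquiv'`** (`M_φ(Ξ(F,Π′^F))(ℂ) ≅ M_φ(Ξ(F′,Π′))(ℂ)`, every `F ⊇ F′`,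
  every `n`).
* §3 (`Θ : CMType K`, `b : ℤ`) **`mtChar_twist`**, **`hgChar_twist`**, `mtCharMap_twist`, `hgCharMap_twist`, **`range_mtCharMap_twist_le`**
  (`X^*(T_{λ^{Π{b}_Θ}}) ⊆ X^*(T_{λ^Π}) + X^*(T_{λ^Θ})`), `range_mtCharMap_le_twist_sup`, **`range_mtCharMap_twist_sup_eq`**, `range_hgCharMap_twist_le`.
* §4 (`Φ : CMType K`) **`mtChar_ofCMType_apply`**, `mtChar_ofCMType_eq_zero_or_eq_one`, **`mtChar_ofCMType_add_mtChar_ofCMType_mul_starRingAut`** (`= 1`),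
  **`hgChar_ofCMType_apply`** (`υ^Φ = ±1`), **`mtChar_ofCMType_mem_infinityTypes_iff`** (`λ^Φ ∈ X^*(S)` iff `IsShimuraCMType Φ`),
  `range_mtCharMap_ofCMType_le_infinityTypes_iff`.

HONEST SCOPE.  Character-module algebra in `Λ` only.  The Galois translate is in hypothesis form (for non-CM `F` a translate `gΠ` need not be an
orientation, g28-#5 §5); the group-level statements for translates (SAME groups) and for induction on `M_φ̃` are the tree's and are not restated; for
half twists no group-level statement (e.g. `M_φ̃(V{-b/2}_Θ)` versus `M_φ̃(V) × M_φ̃(A_Θ)`) is derived here beyond the inclusion of character modules, and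
the converse generation statement of (1.7) («`X^*(S)` is generated by the CM types») is the tree's `SerreGroupCMTypeGenerators` / g30-#8, not redone.

## References
* [MilneShih1982Taniyama] J. S. Milne, K.-y. Shih, *Langlands's construction of the Taniyama group*, LNM 900 (1982) art. III §1 (1.3) p. 231, (1.6)
  p. 232, (1.7) p. 233.
* [GreenGriffithsKerr2012] M. Green, P. Griffiths, M. Kerr, *Mumford–Tate Groups and Domains: Their Geometry and Arithmetic*, Ann. of Math.
  Stud. 183 (2012): (V.A.1) p. 155, (V.A.3)–(V.A.4) p. 156, (V.A.7) p. 157, §V.B pp. 159–160, (V.D.4)–(V.D.5) p. 164, §V.F pp. 172–173, §I.B p. 35.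
* [Deligne1982HodgeCycles] P. Deligne, *Hodge cycles on abelian varieties*, LNM 900 (1982) art. I, Example 3.7 (c).
* [vanGeemen2001HalfTwists] B. van Geemen, *Half twists of Hodge structures of CM-type*, J. Math. Soc. Japan 53 (2001), §2.8.
* [Shimura1998] G. Shimura, *Abelian Varieties with Complex Multiplication and Modular Functions* (1998), §5.2 Thm. 1 (p. 40).
* [Milne2017] J. S. Milne, *Algebraic Groups*, CUP (2017), Ch. 12 Prop. 12.3.

## Provenance
Lane `lit-hodgefound` (Hodge path, Track 2), prover seat `lit-hodgefound-p02` (generation 31), self-proposed row g31-#7 (functoriality of the character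
modules of g31-#1 / g31-#4 under the operations of `OIF(n)`).
-/

noncomputable section

open scoped TensorProduct Classical Pointwise
open Module NumberField

namespace Literature.AlgebraicGeometry.Motives

namespace HodgeStructure

open RealMult (embCoords)
open Literature.NumberTheory.ComplexMultiplication
open Literature.AlgebraicGeometry.Pohlmann1968 (isPretransitive_ringEquiv_complex)

namespace Orientation

/-! ### §1 Galois translates `gΠ`: `λ^{gΠ}_θ = λ^Π_θ(· g)` — right translation in `Λ`; the same orthogonal characters -/

section GaloisTranslate

variable {K : Type} [Field K] {n : ℤ} (g : ℂ ≃+* ℂ) {Λ Λ' : Orientation K n}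

/-- **`λ^{gΠ}_θ(τ) = λ^Π_θ(τg)`**: the `λ` of the Galois translate `gΠ` (`deg_{gΠ} θ = deg_Π(g⁻¹θ)`, hypothesis form as in g28-#5
`Motives/HodgeStructureOfOrientationGaloisTranslates`) is the RIGHT translate by `g` of the `λ` of `Π` — the two embeddings `X^*(M_φ̃) ↪ Λ` through
the cocharacter `μ_Π` and its conjugate `ᵗg μ_Π = μ_{gΠ}` differ by right translation («`𝔐(F)` must also contain `ᵗσμ(f′)`»).
[cite: GreenGriffithsKerr2012, §V.A (V.A.3)–(V.A.4) p. 156, §V.F pp. 172–173] [cite: MilneShih1982Taniyama, III §1 (1.3), (1.6) (p. 231–232)] -/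
theorem mtChar_of_deg_eq (hΛ' : ∀ θ, Λ'.deg θ = Λ.deg (g⁻¹ • θ)) (θ : K →+* ℂ) (τ : ℂ ≃+* ℂ) :
    Λ'.mtChar θ τ = Λ.mtChar θ (τ * g) := by
  rw [mtChar_apply, mtChar_apply, hΛ', mul_inv_rev, mul_smul]

/-- `υ^{gΠ}_θ(τ) = υ^Π_θ(τg)` likewise. [cite: GreenGriffithsKerr2012, §V.A (V.A.3)–(V.A.4) p. 156] -/
theorem hgChar_of_deg_eq (hΛ' : ∀ θ, Λ'.deg θ = Λ.deg (g⁻¹ • θ)) (θ : K →+* ℂ) (τ : ℂ ≃+* ℂ) :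
    Λ'.hgChar θ τ = Λ.hgChar θ (τ * g) := by
  rw [hgChar_eq_two_mul_mtChar_sub, hgChar_eq_two_mul_mtChar_sub, mtChar_of_deg_eq g hΛ']

variable [NumberField K]

/-- **`X^*(ρ_{μ_{gΠ}}) = R_g ∘ X^*(ρ_{μ_Π})`**, `R_g` the right translation `f ↦ f(· g)` of `Λ`.
[cite: GreenGriffithsKerr2012, §V.F pp. 172–173] [cite: MilneShih1982Taniyama, III §1 (1.6) (p. 232)] -/
theorem mtCharMap_of_deg_eq (hΛ' : ∀ θ, Λ'.deg θ = Λ.deg (g⁻¹ • θ)) (c : (K →+* ℂ) → ℤ) (τ : ℂ ≃+* ℂ) :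
    Λ'.mtCharMap c τ = Λ.mtCharMap c (τ * g) := by
  rw [mtCharMap_eq_sum, mtCharMap_eq_sum, Finset.sum_apply, Finset.sum_apply]
  exact Finset.sum_congr rfl fun θ _ => by rw [Pi.smul_apply, Pi.smul_apply, mtChar_of_deg_eq g hΛ']

/-- `Σ c_θ υ^{gΠ}_θ = R_g (Σ c_θ υ^Π_θ)`. [cite: GreenGriffithsKerr2012, §V.F pp. 172–173] -/
theorem hgCharMap_of_deg_eq (hΛ' : ∀ θ, Λ'.deg θ = Λ.deg (g⁻¹ • θ)) (c : (K →+* ℂ) → ℤ) (τ : ℂ ≃+* ℂ) :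
    Λ'.hgCharMap c τ = Λ.hgCharMap c (τ * g) := by
  rw [hgCharMap_apply_eq_two_mul_mtCharMap_sub, hgCharMap_apply_eq_two_mul_mtCharMap_sub, mtCharMap_of_deg_eq g hΛ']

/-- **`gΠ` and `Π` have the SAME characters trivial on the Mumford–Tate group** (`Ker X^*(ρ_{μ_{gΠ}}) = Ker X^*(ρ_{μ_Π})`: right translation is
injective) — the character-side form of g28-#5's `mumfordTateGroupBaseChange_ofOrientation_eq_of_deg_eq` («`M_φ̃(V^n_{(F,gΠ)}) = M_φ̃(V^n_{(F,Π)})`»).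
[cite: GreenGriffithsKerr2012, §I.B p. 35, §V.F pp. 172–173] [cite: Deligne1982HodgeCycles, I Example 3.7 (c)] -/
theorem mtCharMap_eq_zero_iff_of_deg_eq (hΛ' : ∀ θ, Λ'.deg θ = Λ.deg (g⁻¹ • θ)) (c : (K →+* ℂ) → ℤ) :
    Λ'.mtCharMap c = 0 ↔ Λ.mtCharMap c = 0 := by
  constructor
  · intro h
    funext τ
    have := congr_fun h (τ * g⁻¹)
    rwa [mtCharMap_of_deg_eq g hΛ', inv_mul_cancel_right, Pi.zero_apply] at this
  · intro h
    funext τ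
    rw [mtCharMap_of_deg_eq g hΛ', h, Pi.zero_apply, Pi.zero_apply]

/-- The Hodge-group twin: `Ker(Σ c υ^{gΠ}) = Ker(Σ c υ^Π)` (g28-#5 `hodgeGroupBaseChange_ofOrientation_eq_of_deg_eq` on characters).
[cite: GreenGriffithsKerr2012, §I.B p. 35, §V.F pp. 172–173] -/
theorem hgCharMap_eq_zero_iff_of_deg_eq (hΛ' : ∀ θ, Λ'.deg θ = Λ.deg (g⁻¹ • θ)) (c : (K →+* ℂ) → ℤ) :
    Λ'.hgCharMap c = 0 ↔ Λ.hgCharMap c = 0 := by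
  constructor
  · intro h
    funext τ
    have := congr_fun h (τ * g⁻¹)
    rwa [hgCharMap_of_deg_eq g hΛ', inv_mul_cancel_right, Pi.zero_apply] at this
  · intro h
    funext τ
    rw [hgCharMap_of_deg_eq g hΛ', h, Pi.zero_apply, Pi.zero_apply]

/-- **`X^*(T_{λ^{gΠ}}) = R_g X^*(T_{λ^Π})`**: the two character modules are carried onto each other by the right translation `R_g` of `Λ`
(an automorphism of `Λ` commuting with the LEFT Galois action), so `T_{λ^{gΠ}} ≅ T_{λ^Π}` as Galois modules — «`X^*(T_λ)` is the
`Gal(ℚ̄/ℚ)`-submodule generated by `λ`» does not see on which conjugate of `μ` the module is read.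
[cite: MilneShih1982Taniyama, III §1 (1.6) (p. 232)] [cite: GreenGriffithsKerr2012, §V.F pp. 172–173] -/
theorem range_mtCharMap_of_deg_eq (hΛ' : ∀ θ, Λ'.deg θ = Λ.deg (g⁻¹ • θ)) :
    LinearMap.range Λ'.mtCharMap =
      (LinearMap.range Λ.mtCharMap).map (LinearMap.funLeft ℤ ℤ fun τ : ℂ ≃+* ℂ => τ * g) := by
  refine le_antisymm ?_ ?_
  · rintro _ ⟨c, rfl⟩
    exact ⟨Λ.mtCharMap c, LinearMap.mem_range_self _ c, funext fun τ => by
      rw [LinearMap.funLeft_apply, mtCharMap_of_deg_eq g hΛ']⟩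
  · rintro _ ⟨f, ⟨c, rfl⟩, rfl⟩
    exact ⟨c, funext fun τ => by rw [LinearMap.funLeft_apply, mtCharMap_of_deg_eq g hΛ']⟩

/-- `X^*(M_φ)` of `gΠ` is `R_g` of `X^*(M_φ)` of `Π`. [cite: GreenGriffithsKerr2012, §V.F pp. 172–173] -/
theorem range_hgCharMap_of_deg_eq (hΛ' : ∀ θ, Λ'.deg θ = Λ.deg (g⁻¹ • θ)) :
    LinearMap.range Λ'.hgCharMap =
      (LinearMap.range Λ.hgCharMap).map (LinearMap.funLeft ℤ ℤ fun τ : ℂ ≃+* ℂ => τ * g) := by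
  refine le_antisymm ?_ ?_
  · rintro _ ⟨c, rfl⟩
    exact ⟨Λ.hgCharMap c, LinearMap.mem_range_self _ c, funext fun τ => by
      rw [LinearMap.funLeft_apply, hgCharMap_of_deg_eq g hΛ']⟩
  · rintro _ ⟨f, ⟨c, rfl⟩, rfl⟩
    exact ⟨c, funext fun τ => by rw [LinearMap.funLeft_apply, hgCharMap_of_deg_eq g hΛ']⟩

/-- **`X^*(T_{λ^Π}) ≅ X^*(T_{λ^{gΠ}})` by `f ↦ f(· g)`, a `ℤ[Gal]`-linear isomorphism** (right translation commutes with Milne–Shih's left action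
`(σf)(ρ) = f(σ⁻¹ρ)`). [cite: MilneShih1982Taniyama, III §1 (1.3), (1.6) (p. 231–232)] [cite: GreenGriffithsKerr2012, §V.F pp. 172–173] -/
theorem exists_linearEquiv_range_mtCharMap_of_deg_eq (hΛ' : ∀ θ, Λ'.deg θ = Λ.deg (g⁻¹ • θ)) :
    ∃ e : LinearMap.range Λ.mtCharMap ≃ₗ[ℤ] LinearMap.range Λ'.mtCharMap,
      (∀ (f : LinearMap.range Λ.mtCharMap) (τ : ℂ ≃+* ℂ), (e f : (ℂ ≃+* ℂ) → ℤ) τ = (f : (ℂ ≃+* ℂ) → ℤ) (τ * g)) ∧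
        ∀ (σ : ℂ ≃+* ℂ) (f : LinearMap.range Λ.mtCharMap),
          (e ⟨characterRep (ℂ ≃+* ℂ) (ℂ ≃+* ℂ) σ f, Λ.characterRep_mem_range_mtCharMap σ f.2⟩ : (ℂ ≃+* ℂ) → ℤ) =
            characterRep (ℂ ≃+* ℂ) (ℂ ≃+* ℂ) σ (e f) := by
  let R : ((ℂ ≃+* ℂ) → ℤ) ≃ₗ[ℤ] ((ℂ ≃+* ℂ) → ℤ) := LinearEquiv.funCongrLeft ℤ ℤ (Equiv.mulRight g)
  have hR : ∀ f τ, R f τ = f (τ * g) := fun f τ => rfl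
  have hRmap : (LinearMap.range Λ.mtCharMap).map (R : ((ℂ ≃+* ℂ) → ℤ) →ₗ[ℤ] ((ℂ ≃+* ℂ) → ℤ)) =
      LinearMap.range Λ'.mtCharMap := by
    rw [range_mtCharMap_of_deg_eq g hΛ']
    rfl
  refine ⟨(R.submoduleMap (LinearMap.range Λ.mtCharMap)).trans (LinearEquiv.ofEq _ _ hRmap), fun f τ => rfl, fun σ f => ?_⟩
  funext τ
  show (f : (ℂ ≃+* ℂ) → ℤ) (σ⁻¹ • (τ * g)) = (f : (ℂ ≃+* ℂ) → ℤ) ((σ⁻¹ • τ) * g)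
  rw [smul_eq_mul, smul_eq_mul, mul_assoc]

end GaloisTranslate

/-! ### §2 Induced orientations `Π = Π′^F`: `λ^Π_θ = λ^{Π′}_{θ|F′}` — `X^*(T_λ) ⊆ Λ` is the SAME submodule -/

section Induced

variable {F F' : Type} [Field F] [NumberField F] [Field F'] [NumberField F'] {n : ℤ} (k : F' →+* F) (Λ' : Orientation F' n)

omit [NumberField F] [NumberField F'] in
/-- **`λ^{Π′^F}_θ = λ^{Π′}_{θ∘k}`**: the `λ` of an induced orientation at `θ : F → ℂ` is the `λ` of `Π′` at the restriction `θ|_{F′}` (restriction of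
embeddings is `Aut(ℂ)`-equivariant). [cite: GreenGriffithsKerr2012, (V.A.1) (ii), (iv) p. 155] [cite: MilneShih1982Taniyama, III §1 (1.6) (p. 232)] -/
theorem mtChar_induced (θ : F →+* ℂ) : (Λ'.induced k).mtChar θ = Λ'.mtChar (θ.comp k) := by
  funext τ
  rw [mtChar_apply, mtChar_apply, induced_deg]
  rfl

omit [NumberField F] [NumberField F'] in
/-- `υ^{Π′^F}_θ = υ^{Π′}_{θ∘k}`. [cite: GreenGriffithsKerr2012, (V.A.1) (ii), (iv) p. 155] -/
theorem hgChar_induced (θ : F →+* ℂ) : (Λ'.induced k).hgChar θ = Λ'.hgChar (θ.comp k) := by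
  funext τ
  rw [hgChar_eq_two_mul_mtChar_sub, hgChar_eq_two_mul_mtChar_sub, mtChar_induced]

/-- Every complex embedding of `F′` extends along `k : F′ → F` (`Aut(ℂ)` is transitive on `Hom(F′,ℂ)`). [folklore] -/
private theorem exists_comp_eq_fn (σ₀ : F' →+* ℂ) : ∃ σ : F →+* ℂ, σ.comp k = σ₀ := by
  obtain ⟨σ₁⟩ : Nonempty (F →+* ℂ) := inferInstance
  haveI := isPretransitive_ringEquiv_complex (K := F')
  obtain ⟨τ, hτ⟩ := MulAction.exists_smul_eq (ℂ ≃+* ℂ) (σ₁.comp k) σ₀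
  refine ⟨τ.toRingHom.comp σ₁, ?_⟩
  rw [RingHom.comp_assoc, ← ringEquiv_smul_def]
  exact hτ

/-- **`X^*(ρ_{μ_Π}) c = X^*(ρ_{μ_{Π′}})(res c)`**, `res : X^*(Res_{F/ℚ}𝔾_m) → X^*(Res_{F′/ℚ}𝔾_m)`, `(res c)_{σ₀} = Σ_{θ|F′ = σ₀} c_θ` the restriction of
characters along `T_{F′} ↪ T_F` (`[θ]|_{T_{F′}} = [θ|_{F′}]`). [cite: GreenGriffithsKerr2012, (V.A.1) (iv) p. 155, §V.D (V.D.4) p. 164] -/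
theorem mtCharMap_induced (c : (F →+* ℂ) → ℤ) :
    (Λ'.induced k).mtCharMap c = Λ'.mtCharMap fun σ₀ => ∑ θ ∈ Finset.univ.filter (fun θ : F →+* ℂ => θ.comp k = σ₀), c θ := by
  funext τ
  rw [mtCharMap_apply, mtCharMap_apply]
  simp_rw [Finset.sum_mul]
  rw [← Finset.sum_fiberwise_of_maps_to (g := fun θ : F →+* ℂ => θ.comp k) (fun θ _ => Finset.mem_univ (θ.comp k))]
  refine Finset.sum_congr rfl fun σ₀ _ => Finset.sum_congr rfl fun θ hθ => ?_
  rw [Finset.mem_filter] at hθ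
  rw [induced_deg, ← hθ.2]
  rfl

/-- **`X^*(T_{λ^{Π′^F}}) = X^*(T_{λ^{Π′}})` as submodules of `Λ`**: the Mumford–Tate character modules of `V^n_{(F,Π′^F)}` and `V^n_{(F′,Π′)}`
COINCIDE — «`T_λ` is the torus with `X^*(T_λ) = ℤ[Gal]·λ`» and the two `λ` agree (§2's first statement; every embedding of `F′` extends to `F`).
[cite: MilneShih1982Taniyama, III §1 (1.6) (p. 232)] [cite: GreenGriffithsKerr2012, (V.A.1) (iv) p. 155, §V.D p. 164] -/
theorem range_mtCharMap_induced : LinearMap.range (Λ'.induced k).mtCharMap = LinearMap.range Λ'.mtCharMap := by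
  rw [range_mtCharMap_eq_span, range_mtCharMap_eq_span]
  refine congrArg (Submodule.span ℤ) (Set.ext fun f => ⟨?_, ?_⟩)
  · rintro ⟨θ, rfl⟩
    exact ⟨θ.comp k, (mtChar_induced k Λ' θ).symm⟩
  · rintro ⟨σ₀, rfl⟩
    obtain ⟨θ, hθ⟩ := exists_comp_eq_fn k σ₀
    exact ⟨θ, by rw [mtChar_induced, hθ]⟩

/-- `X^*(M_φ)` is likewise the same submodule of `Λ` for `Π′^F` and `Π′`. [cite: GreenGriffithsKerr2012, (V.A.1) (iv) p. 155, (V.D.5) p. 164] -/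
theorem range_hgCharMap_induced : LinearMap.range (Λ'.induced k).hgCharMap = LinearMap.range Λ'.hgCharMap := by
  rw [range_hgCharMap_eq_span, range_hgCharMap_eq_span]
  refine congrArg (Submodule.span ℤ) (Set.ext fun f => ⟨?_, ?_⟩)
  · rintro ⟨θ, rfl⟩
    exact ⟨θ.comp k, (hgChar_induced k Λ' θ).symm⟩
  · rintro ⟨σ₀, rfl⟩
    obtain ⟨θ, hθ⟩ := exists_comp_eq_fn k σ₀
    exact ⟨θ, by rw [hgChar_induced, hθ]⟩

/-- Restricted orientations (`Π` induced from `K₀ ⊆ F`): `X^*(T_λ)` of `Π|_{K₀}` is `X^*(T_λ)` of `Π`. [cite: GreenGriffithsKerr2012, (V.A.1) (ii) p. 155] -/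
theorem range_mtCharMap_restrict {K₀ : IntermediateField ℚ F} (Λ : Orientation F n) (h : Λ.IsInducedFrom K₀) :
    LinearMap.range (Λ.restrict K₀ h).mtCharMap = LinearMap.range Λ.mtCharMap := by
  conv_rhs => rw [← Λ.induced_restrict h]
  exact (range_mtCharMap_induced (algebraMap K₀ F) (Λ.restrict K₀ h)).symm

/-- … and `X^*(M_φ)` of `Π|_{K₀}` is `X^*(M_φ)` of `Π`. [cite: GreenGriffithsKerr2012, (V.A.1) (ii) p. 155] -/
theorem range_hgCharMap_restrict {K₀ : IntermediateField ℚ F} (Λ : Orientation F n) (h : Λ.IsInducedFrom K₀) :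
    LinearMap.range (Λ.restrict K₀ h).hgCharMap = LinearMap.range Λ.hgCharMap := by
  conv_rhs => rw [← Λ.induced_restrict h]
  exact (range_hgCharMap_induced (algebraMap K₀ F) (Λ.restrict K₀ h)).symm

variable [HodgeTensorFacts.{0, 0}]

/-- **`M_φ(V^n_{(F,Π′^F)})(ℂ) ≅ M_φ(V^n_{(F′,Π′)})(ℂ)` for EVERY `F ⊇ F′` and every weight** (both are `Hom(X^*(M_φ), ℂ^×)` for the SAME
`X^*(M_φ) ⊆ Λ`, g31-#4) — the tree's `nonempty_hodgeGroupBaseChange_complex_induced_mulEquiv` assumed `F, F′` CM and `n ≠ 0`.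
[cite: GreenGriffithsKerr2012, §V.D (V.D.4)–(V.D.5) p. 164] [cite: Milne2017, Ch. 12 Prop. 12.3] -/
theorem nonempty_hodgeGroupBaseChange_complex_induced_mulEquiv' :
    Nonempty ((ofOrientation (Λ'.induced k)).hodgeGroupBaseChange ℂ ≃* (ofOrientation Λ').hodgeGroupBaseChange ℂ) := by
  obtain ⟨e₁, -⟩ := (Λ'.induced k).exists_mulEquiv_hodgeGroupBaseChange_complex_ofOrientation_characterHom
  obtain ⟨e₂, -⟩ := Λ'.exists_mulEquiv_hodgeGroupBaseChange_complex_ofOrientation_characterHom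
  have h : LinearMap.range (Λ'.induced k).hgCharMap = LinearMap.range Λ'.hgCharMap := range_hgCharMap_induced k Λ'
  let e₃ : Multiplicative (LinearMap.range (Λ'.induced k).hgCharMap) ≃* Multiplicative (LinearMap.range Λ'.hgCharMap) :=
    AddEquiv.toMultiplicative (LinearEquiv.ofEq _ _ h).toAddEquiv
  exact ⟨e₁.trans (e₃.monoidHomCongrLeft.trans e₂.symm)⟩

end Induced

/-! ### §3 Half twists `Π{b}_Θ`: `λ^{Π{b}_Θ} = λ^Π + b·λ^Θ`, `υ^{Π{b}_Θ} = υ^Π + b·υ^Θ` -/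

section Twist

variable {K : Type} [Field K] {n : ℤ} (Λ : Orientation K n) (Θ : CMType K) (b : ℤ)

/-- **`λ^{Π{b}_Θ}_θ = λ^Π_θ + b·λ^Θ_θ`**: the `λ` of the twisted `(n+b)`-orientation `Π{b}_Θ` (`deg θ + b` on `Θ`, `deg θ` off `Θ`; the orientation of
the half twist `V{-b/2}_Θ`, «`V{-b/2}^{P,Q} := V_+^{P−b,Q} ⊕ V_-^{P,Q−b}`») is the `λ` of `Π` plus `b` times the `λ` of the CM type `Θ`
(`X^*` is additive under the twist by the character of `T_Θ`).
[cite: GreenGriffithsKerr2012, §V.B p. 159 (definition of V{-b/2}) and p. 160] [cite: vanGeemen2001HalfTwists, §2.8] [cite: MilneShih1982Taniyama, III §1 (1.6) (p. 232)] -/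
theorem mtChar_twist (θ : K →+* ℂ) : (Λ.twist Θ b).mtChar θ = Λ.mtChar θ + b • (ofCMType Θ).mtChar θ := by
  funext τ
  rw [Pi.add_apply, Pi.smul_apply, smul_eq_mul, mtChar_apply, mtChar_apply, mtChar_apply]
  by_cases h : τ⁻¹ • θ ∈ Θ.1
  · rw [Λ.twist_deg_of_mem b h, ofCMType_deg_of_mem Θ h, mul_one]
  · rw [Λ.twist_deg_of_not_mem b h, ofCMType_deg_of_not_mem Θ h, mul_zero, add_zero]

/-- **`υ^{Π{b}_Θ}_θ = υ^Π_θ + b·υ^Θ_θ`** (`2(λ + bλ_Θ) − (n + b) = (2λ − n) + b(2λ_Θ − 1)`).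
[cite: GreenGriffithsKerr2012, §V.B p. 159–160] [cite: vanGeemen2001HalfTwists, §2.8] -/
theorem hgChar_twist (θ : K →+* ℂ) : (Λ.twist Θ b).hgChar θ = Λ.hgChar θ + b • (ofCMType Θ).hgChar θ := by
  funext τ
  simp only [Pi.add_apply, Pi.smul_apply, smul_eq_mul, hgChar_eq_two_mul_mtChar_sub, mtChar_twist]
  ring

variable [NumberField K]

/-- **`X^*(ρ_{μ_{Π{b}_Θ}}) = X^*(ρ_{μ_Π}) + b·X^*(ρ_{μ_Θ})`** as maps `X^*(Res_{F/ℚ}𝔾_m) → Λ`. [cite: GreenGriffithsKerr2012, §V.B p. 159–160]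
[cite: MilneShih1982Taniyama, III §1 (1.6) (p. 232)] -/
theorem mtCharMap_twist (c : (K →+* ℂ) → ℤ) :
    (Λ.twist Θ b).mtCharMap c = Λ.mtCharMap c + b • (ofCMType Θ).mtCharMap c := by
  rw [mtCharMap_eq_sum, mtCharMap_eq_sum, mtCharMap_eq_sum, Finset.smul_sum, ← Finset.sum_add_distrib]
  refine Finset.sum_congr rfl fun θ _ => ?_
  rw [mtChar_twist, smul_add, smul_comm]

/-- `Σ c υ^{Π{b}_Θ} = Σ c υ^Π + b·Σ c υ^Θ`. [cite: GreenGriffithsKerr2012, §V.B p. 159–160] -/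
theorem hgCharMap_twist (c : (K →+* ℂ) → ℤ) :
    (Λ.twist Θ b).hgCharMap c = Λ.hgCharMap c + b • (ofCMType Θ).hgCharMap c := by
  rw [hgCharMap_eq_sum, hgCharMap_eq_sum, hgCharMap_eq_sum, Finset.smul_sum, ← Finset.sum_add_distrib]
  refine Finset.sum_congr rfl fun θ _ => ?_
  rw [hgChar_twist, smul_add, smul_comm]

/-- **`X^*(T_{λ^{Π{b}_Θ}}) ⊆ X^*(T_{λ^Π}) + X^*(T_{λ^Θ})` in `Λ`**: the Mumford–Tate character module of the half twist lies in the sum of those of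
`V^n_{(F,Π)}` and of the CM Hodge structure `V¹_{(F,Θ)}` — `M_φ̃(V{-b/2}_Θ)` is a quotient of a subtorus of `M_φ̃(V) × M_φ̃(A_Θ)` (the half twist
is cut out of `V ⊗` a CM tensor construction on `A_Θ`). [cite: GreenGriffithsKerr2012, §V.B p. 159–160] [cite: vanGeemen2001HalfTwists, §2.8]
[cite: MilneShih1982Taniyama, III §1 (1.6) (p. 232)] -/
theorem range_mtCharMap_twist_le :
    LinearMap.range (Λ.twist Θ b).mtCharMap ≤ LinearMap.range Λ.mtCharMap ⊔ LinearMap.range (ofCMType Θ).mtCharMap := by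
  rintro _ ⟨c, rfl⟩
  rw [mtCharMap_twist]
  exact Submodule.add_mem_sup (LinearMap.mem_range_self _ c) (Submodule.smul_mem _ _ (LinearMap.mem_range_self _ c))

/-- Conversely `X^*(T_{λ^Π}) ⊆ X^*(T_{λ^{Π{b}_Θ}}) + X^*(T_{λ^Θ})` (`Π = (Π{b}_Θ){−b}_Θ` on `λ`'s). [cite: GreenGriffithsKerr2012, §V.B p. 159–160 («V{b/2}_Θ{−b/2}_Θ = V»)] -/
theorem range_mtCharMap_le_twist_sup :
    LinearMap.range Λ.mtCharMap ≤ LinearMap.range (Λ.twist Θ b).mtCharMap ⊔ LinearMap.range (ofCMType Θ).mtCharMap := by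
  rintro _ ⟨c, rfl⟩
  have h : Λ.mtCharMap c = (Λ.twist Θ b).mtCharMap c - b • (ofCMType Θ).mtCharMap c := by
    rw [mtCharMap_twist, add_sub_cancel_right]
  rw [h]
  exact Submodule.sub_mem_sup (LinearMap.mem_range_self _ c) (Submodule.smul_mem _ _ (LinearMap.mem_range_self _ c))

/-- **`X^*(T_{λ^{Π{b}_Θ}}) + X^*(T_{λ^Θ}) = X^*(T_{λ^Π}) + X^*(T_{λ^Θ})`**: `V{-b/2}_Θ ⊕ A_Θ` and `V ⊕ A_Θ` have the same Mumford–Tate character module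
in `Λ` (hence isogenous-type Mumford–Tate tori). [cite: GreenGriffithsKerr2012, §V.B p. 159–160] [cite: vanGeemen2001HalfTwists, §2.8] -/
theorem range_mtCharMap_twist_sup_eq :
    LinearMap.range (Λ.twist Θ b).mtCharMap ⊔ LinearMap.range (ofCMType Θ).mtCharMap =
      LinearMap.range Λ.mtCharMap ⊔ LinearMap.range (ofCMType Θ).mtCharMap :=
  le_antisymm (sup_le ((range_mtCharMap_twist_le Λ Θ b).trans le_rfl) le_sup_right)
    (sup_le (range_mtCharMap_le_twist_sup Λ Θ b) le_sup_right)

/-- The Hodge-group version: `X^*(M_φ(Π{b}_Θ)) ⊆ X^*(M_φ(Π)) + X^*(M_φ(Θ))`. [cite: GreenGriffithsKerr2012, §V.B p. 159–160] -/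
theorem range_hgCharMap_twist_le :
    LinearMap.range (Λ.twist Θ b).hgCharMap ≤ LinearMap.range Λ.hgCharMap ⊔ LinearMap.range (ofCMType Θ).hgCharMap := by
  rintro _ ⟨c, rfl⟩
  rw [hgCharMap_twist]
  exact Submodule.add_mem_sup (LinearMap.mem_range_self _ c) (Submodule.smul_mem _ _ (LinearMap.mem_range_self _ c))

end Twist

/-! ### §4 CM types: `λ^Φ_θ ∈ {0,1}`, `λ^Φ_θ(τ) + λ^Φ_θ(τι) = 1` — Milne–Shih (1.7)'s generators; `υ^Φ_θ = ±1` (Shimura's `φ − φρ`) -/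

section CMType

variable {K : Type} [Field K] (Φ : CMType K)

/-- **`λ^Φ_θ(τ) = [τ⁻¹θ ∈ Φ]`**: the `λ` of the `1`-orientation of a CM type is the translated indicator.
[cite: MilneShih1982Taniyama, III §1 (1.7) (p. 233)] [cite: GreenGriffithsKerr2012, §V.A p. 154] -/
theorem mtChar_ofCMType_apply (θ : K →+* ℂ) (τ : ℂ ≃+* ℂ) :
    (ofCMType Φ).mtChar θ τ = if τ⁻¹ • θ ∈ Φ.1 then 1 else 0 := by
  rw [mtChar_apply]
  by_cases h : τ⁻¹ • θ ∈ Φ.1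
  · rw [ofCMType_deg_of_mem Φ h, if_pos h]
  · rw [ofCMType_deg_of_not_mem Φ h, if_neg h]

/-- **«`λ(σ)` is `0` or `1`»**. [cite: MilneShih1982Taniyama, III §1 (1.7) (p. 233)] -/
theorem mtChar_ofCMType_eq_zero_or_eq_one (θ : K →+* ℂ) (τ : ℂ ≃+* ℂ) :
    (ofCMType Φ).mtChar θ τ = 0 ∨ (ofCMType Φ).mtChar θ τ = 1 := by
  rw [mtChar_ofCMType_apply]
  by_cases h : τ⁻¹ • θ ∈ Φ.1
  · exact Or.inr (if_pos h)
  · exact Or.inl (if_neg h)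

/-- **«`λ(σ) + λ(ισ) = 1`»** (for the RIGHT translate by `ι`, unconditionally; for Milne–Shih's left action iff `(F; Φ)` is a CM-type in Shimura's
sense, §4's last statement). [cite: MilneShih1982Taniyama, III §1 (1.7) (p. 233)] -/
theorem mtChar_ofCMType_add_mtChar_ofCMType_mul_starRingAut (θ : K →+* ℂ) (τ : ℂ ≃+* ℂ) :
    (ofCMType Φ).mtChar θ τ + (ofCMType Φ).mtChar θ (τ * starRingAut) = 1 := by
  rw [mtChar_mul_starRingAut]
  ring

/-- **`υ^Φ_θ(τ) = ±1`**: `+1` if `τ⁻¹θ ∈ Φ`, `−1` if not (Shimura's `T(φ − φρ)` generators). [cite: GreenGriffithsKerr2012, (V.A.7) p. 157]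
[cite: MilneShih1982Taniyama, III §1 (1.7) (p. 233)] -/
theorem hgChar_ofCMType_apply (θ : K →+* ℂ) (τ : ℂ ≃+* ℂ) :
    (ofCMType Φ).hgChar θ τ = if τ⁻¹ • θ ∈ Φ.1 then 1 else -1 := by
  rw [hgChar_eq_two_mul_mtChar_sub, mtChar_ofCMType_apply]
  split_ifs <;> norm_num

variable [NumberField K]

/-- **`λ^Φ_θ ∈ X^*(S)` iff `(F; Φ)` is a CM-type in Shimura's sense** ((CM1)+(CM2): `Φ` lifted from a CM type of a CM subfield) — (1.7)'s
generators are exactly the `λ^Φ` of the SHIMURA CM types (g31-#1 §4 + g30-#8 `ofCMType_deg_mem_charGroup_iff_isShimuraCMType`).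
[cite: MilneShih1982Taniyama, III §1 (1.7) (p. 233)] [cite: Shimura1998, §5.2 Thm. 1 (p. 40)] -/
theorem mtChar_ofCMType_mem_infinityTypes_iff (θ : K →+* ℂ) :
    (ofCMType Φ).mtChar θ ∈ infinityTypes (ℂ ≃+* ℂ) (ℂ ≃+* ℂ) (starRingAut : ℂ ≃+* ℂ) ↔ IsShimuraCMType Φ.1 := by
  rw [mtChar_mem_infinityTypes_iff_deg_mem_charGroup, ofCMType_deg_mem_charGroup_iff_isShimuraCMType]

/-- `X^*(T_{λ^Φ}) ⊆ X^*(S)` iff `(F; Φ)` is a Shimura CM type (iff `V¹_{(F,Φ)}` is polarizable, iff it comes from a CM abelian variety).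
[cite: MilneShih1982Taniyama, III §1 (1.7) (p. 233)] [cite: Shimura1998, §5.2 Thm. 1 (p. 40)] -/
theorem range_mtCharMap_ofCMType_le_infinityTypes_iff [Nonempty (K →+* ℂ)] :
    LinearMap.range (ofCMType Φ).mtCharMap ≤ infinityTypes (ℂ ≃+* ℂ) (ℂ ≃+* ℂ) (starRingAut : ℂ ≃+* ℂ) ↔
      IsShimuraCMType Φ.1 := by
  rw [range_mtCharMap_le_infinityTypes_iff, isPolarizable_ofOrientation_ofCMType_iff_isShimuraCMType]

end CMType

end Orientation

end HodgeStructure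

end Literature.AlgebraicGeometry.Motives
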